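import Literature.NumberTheory.GaloisRepresentations.ModNCyclotomicCharacter
import HarnessLib

/-!
# X3, the DEGENERATE rows OFF the sub-locus: a DEPENDENCY among layer T-side classes is an additive,
# locally constant `ℤ/3`-valued character vanishing on `G_{ℚ_∞}` (cell `bsd-eis`, seat `bsd-eis-x3`
# gen 7; glue between the counting lemma
# `TrivialLineClasses.pow_card_le_natCard_of_classes_of_injective` (its hypothesis `hinj`) and the
# tower steps `LayerCharTower.exists_layerSubgroup_subset_of_isLocallyConstant` /
# `LayerCharTower.exists_addCharOn_eq_mul` of the independence argument F5, MEMO-9 §2.4 (f); route K1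
# `AdditiveBranchIMC`, crux `GordTwoRankZeroOffCaseOne` — supports only)

HONEST FRAMING (`run/shared/lean/pub/bsd-eis/README.md` §4): THEOREMS ONLY (no `def`, no named fact,
no `sorry`); nothing is booked; no label, tier or count of record moves.

* `dependency_char` — characters `χ_i : Γ → ℤ/3` (locally constant, additive on `G'`), `x₀` of
  additive order `3`, coefficient vectors `k, k'` with `Σ (k i).val • (χ_i h).val • x₀ =
  Σ (k' i).val • (χ_i h).val • x₀` for all `h ∈ H`: then `ψ = Σ (k i − k' i)·χ_i` is locally constant,
  additive on `G'`, and vanishes on `H`.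
References: [SerreGaloisCohomology1997] I.§2; [Washington1997] §13.1.
-/

set_option autoImplicit false

namespace Summit.BirchSwinnertonDyer.Rank1Residual.Additive

namespace LayerCharTower

/-- **A dependency among layer T-side classes as a character.** See the module docstring.
[folklore] -/
theorem dependency_char {Γ : Type*} [Group Γ] [TopologicalSpace Γ]
    {Φ : Type*} [AddCommGroup Φ]
    (G' H : Subgroup Γ) {ι : Type} [Fintype ι] [DecidableEq ι]
    (χ : ι → Γ → ZMod 3) (hlc : ∀ i, IsLocallyConstant (χ i))
    (hadd : ∀ i, ∀ a ∈ G', ∀ b ∈ G', χ i (a * b) = χ i a + χ i b)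
    (x₀ : Φ) (hx₀ : addOrderOf x₀ = 3) (k k' : ι → ZMod 3)
    (heq : ∀ h ∈ H, (∑ i, (k i).val • ((χ i h).val • x₀)) = ∑ i, (k' i).val • ((χ i h).val • x₀)) :
    IsLocallyConstant (fun g ↦ ∑ i, (k i - k' i) * χ i g) ∧
      (∀ a ∈ G', ∀ b ∈ G',
        (∑ i, (k i - k' i) * χ i (a * b)) =
          (∑ i, (k i - k' i) * χ i a) + ∑ i, (k i - k' i) * χ i b) ∧
      ∀ h ∈ H, (∑ i, (k i - k' i) * χ i h) = 0 := by
  refine ⟨?_, fun a ha b hb ↦ ?_, fun h hh ↦ ?_⟩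
  · -- locally constant: factor through the locally constant `g ↦ (χ i g)_i` into a discrete space
    have hv : IsLocallyConstant (fun g ↦ fun i ↦ χ i g : Γ → ι → ZMod 3) :=
      (IsLocallyConstant.iff_continuous _).mpr
        (continuous_pi fun i ↦ (IsLocallyConstant.iff_continuous _).mp (hlc i))
    exact hv.comp (fun v : ι → ZMod 3 ↦ ∑ i, (k i - k' i) * v i)
  · -- additivity on `G'`
    rw [← Finset.sum_add_distrib]
    exact Finset.sum_congr rfl fun i _ ↦ by rw [hadd i a ha b hb, mul_add]
  · -- vanishing on `H`: compare the two multiples of `x₀`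
    have hN : (∑ i, (k i).val • ((χ i h).val • x₀)) = (∑ i, (k i).val * (χ i h).val) • x₀ := by
      rw [Finset.sum_smul]
      exact Finset.sum_congr rfl fun i _ ↦ (mul_smul _ _ _).symm
    have hM : (∑ i, (k' i).val • ((χ i h).val • x₀)) = (∑ i, (k' i).val * (χ i h).val) • x₀ := by
      rw [Finset.sum_smul]
      exact Finset.sum_congr rfl fun i _ ↦ (mul_smul _ _ _).symm
    have h1 := heq h hh
    rw [hN, hM, nsmul_inj_mod, hx₀] at h1
    have h2 : ((∑ i, (k i).val * (χ i h).val : ℕ) : ZMod 3) =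
        ((∑ i, (k' i).val * (χ i h).val : ℕ) : ZMod 3) :=
      (ZMod.natCast_eq_natCast_iff' _ _ 3).mpr h1
    push_cast at h2
    simp only [ZMod.natCast_val, ZMod.cast_id', id_eq] at h2
    rw [Finset.sum_congr rfl fun i _ ↦ sub_mul (k i) (k' i) (χ i h), Finset.sum_sub_distrib, h2,
      sub_self]

end LayerCharTower

end Summit.BirchSwinnertonDyer.Rank1Residual.Additive
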